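import Summits.QuantumFields.BalabanUV.Beta.GAN24.CurrentSymTower
import Summits.QuantumFields.BalabanUV.Beta.GAN24.CubicSectorCurrentSymOfWardLetters
import Summits.QuantumFields.BalabanUV.Beta.GAN24.LambdaSectorClassSlotOfTables

/-!
# `BalabanUV.Beta.GAN24.CurrentSymTowerOfTables` — binder row G-an2-4 ∕ (CONV-C), TRANSFER-III, the TABLE-GENERIC twin of this lineage's F5 (A)-tower `CurrentSymSectorSplit` §3–§4 + `CurrentSymTower`
# §1–§2 (g69∕g70): **FOR THE SLOTTED STEP FAMILIES `SrecOf d Lc V H G` AND `SpureRecOf d Lc V H G` — ANY border table `V` with (LV) and ONE displayed V-letter (the slot↔leg-symmetrised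
# two-datum contraction of `V` vanishes for exit-face-supported single-coordinate data), ANY Hessian table `H` with (LH), ANY resolvent family `G` with (DG)(SG) and the Ward response letters
# (R-H)(R-M) at every level — EVERY SLOT↔LEG-SYMMETRISED CLASS-WEIGHTED TWO-LEG CURRENT VANISHES AT EVERY LEVEL AND EVERY FREE LEG.**

NOT IN PRINT; OUR BOOKKEEPING ([folklore] `Nat.rec` + `tsum` bookkeeping BY NAME over an2's slot files `RecursiveStencilSlot` (`SrecOf ∕ SrecOf_zero ∕ SrecOf_succ ∕ S0NOf ∕ SpureRecOf ∕
SpureRecOf_zero_level ∕ SpureRecOf_succ ∕ locStencil_SrecOf`), `ValueJetGeneric.locStencil_e3OfK`, this lineage's g69∕g70 `CurrentSymSectorSplit.summable_leg_slot_fst ∕ abs_classDatum_le`,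
`ExitFaceCurrentSectorSplit.summable_slot_locStencil`, `CurrentSymTower.classCurrent_add_smul_eq`, `WilsonCurrentSym.sym_wilsonA`, an3∕an2's `StepJetData.locStencil_wilsonA`, and this gen's (M1b)
`CubicSectorCurrentSymOfWardLetters.sym_e3OfK_of_wardLetters`, (M3) `LambdaSectorClassSlotOfTables`; G-an2-4 CRUX TEAM (2), leaf prover `b2b-balaban-gan24-formalise-leaf-04`, gen 77).  HONEST FRAMING (cell
contract, verbatim): «discharging `BetaPertH` makes Bałaban's UV stability UNCONDITIONAL — a real constructive-QFT result; it is NOT the continuum limit and NOT the Clay problem.»  HONEST DEPENDENCY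
(verbatim): «continuum YM on T⁴ ⇐ BetaPertH ∧ nine spine estimates (0/9 proved); BetaPertH ⇐ (D1) ∧ (D4) ∧ CAP+tail; G-an2-4 gates asym, D1 and NE2/3/4.»

CONVENTION: `P_T[s,h](p,a) := Σ'_q h(q_β)·Σ'_u s(u_ν)·T ν u q p (inl β) a + Σ'_q s(q_ν)·Σ'_u h(u_β)·T β u q p (inl ν) a`, class data `c + dΦ` (bounded `Φ`), face-supported when zero off `{n % Lc = Lc−1}`.

WHAT ([folklore]; generic `d`, `[NeZero Lc]`, all `cE cVH cΛ`; 0 `def`, 0 cited facts, 0 `def … : Prop`, 0 sorry): §1 `exists_locStencil_eSectorOf`; §2 `classCurrent_SrecOf_succ_eq`, `sym_SrecOf_succ_of_sectors` (level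
`j+1`: cubic + border sectors; the Λ sector dies by (M3)); §3 `classCurrent_S0NOf_eq`, `sym_S0NOf_of_sectors` (level `0`: Wilson + border); §4 **`sym_SrecOf_all`** (THE SLOTTED (A)-TOWER: every `j`,
all `ν β`, all face-supported class data, every free leg — induction with (M1b)'s step and `sym_wilsonA`); §5 **`sym_SpureRecOf`** (the pure tables, every `j`).  The (III′) instance (an1's record
+ an2's comb resolvents; the letter `hCS` of (G) `CombForcingPairForm` §5) is the sibling file `CurrentSymTowerComb`.  Asserts NO value of Bałaban's tables; discharges NOTHING of (C)sym ∕
(hW, hWall) ∕ (hS, hSall); NEVER «G-an2-4 closed» as (CONV-C); NOT D1, NOT `BetaPertH`, NOT continuum, NOT Clay.  2026-08-25; no existing file touched.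
-/

noncomputable section

open Finset
open scoped BigOperators
open Literature.MathematicalPhysics.QuantumFieldTheory
open Literature.MathematicalPhysics.QuantumFieldTheory.Balaban1983to89
open Literature.MathematicalPhysics.QuantumFieldTheory.Balaban1983to89.Beta
open ExpKernelCalculus (Site MKer Decays VertexFamily)
open AffineAveraging (box toSite)
open AveragingContours (blk)
open OneStepResolventKernel (Fib LocStencil KInv)
open OneStepKernelFamily (KInvStep colH)
open StepJetData (wilsonA locStencil_wilsonA)
open BalabanStepJets (lamCoeffOf)
open BalabanStepJetsSucc (lamCoeffK E2 wE wVH wΛ)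
open InterLevelTransport (SLam)
open Summit.QuantumFields.BalabanUV.Beta.TameKernelCalculus (trK)
open Summit.QuantumFields.BalabanUV.Beta.BorderedHessian (sgnK)
open Summit.QuantumFields.BalabanUV.Beta.SpineRooted (e3OfK S0NOf SpureRecOf SpureRecOf_zero_level SpureRecOf_succ locStencil_SrecOf locStencil_e3OfK)
open Summit.QuantumFields.BalabanUV.Beta.WardLocusRecursive (SrecOf SrecOf_zero SrecOf_succ)
open Summit.QuantumFields.BalabanUV.Beta.GAN24.ExitFaceCurrentSectorSplit (summable_slot_locStencil)
open Summit.QuantumFields.BalabanUV.Beta.GAN24.CurrentSymSectorSplit (summable_leg_slot_fst abs_classDatum_le)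
open Summit.QuantumFields.BalabanUV.Beta.GAN24.CurrentSymTower (classCurrent_add_smul_eq)
open Summit.QuantumFields.BalabanUV.Beta.GAN24.WilsonCurrentSym (sym_wilsonA)
open Summit.QuantumFields.BalabanUV.Beta.GAN24.CubicSectorCurrentSymOfWardLetters (sym_e3OfK_of_wardLetters)
open Summit.QuantumFields.BalabanUV.Beta.GAN24.LambdaSectorClassSlotOfTables (tsum_classSlot_lamSectorK_eq_zero_of_tables tsum_classSlot_lamSectorOf_eq_zero_of_tables
  exists_locStencil_lamSectorK_of_tables exists_locStencil_lamSectorOf_of_tables)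

namespace Summit.QuantumFields.BalabanUV.Beta.GAN24.CurrentSymTowerOfTables

variable {d : ℕ} {Lc : ℕ} [NeZero Lc]
variable {V H : Fin (d + 1) → (Fin (d + 1) → ℤ) → MKer (d + 1) (Fib d)} {G : ℕ → MKer (d + 1) (Fib d)}

/-! ## §1 The cubic sector of the slotted family is local -/

/-- [folklore] The cubic sector `e3OfK Lc (G j) (SrecOf … j)` of member `j+1` is a local stencil family under (LV)(LH)(DG) (an2's `locStencil_SrecOf` + `locStencil_e3OfK`). -/
theorem exists_locStencil_eSectorOf (hV : ∀ δ : ℝ, 0 ≤ δ → ∃ C : ℝ, LocStencil V C δ) (hH : ∀ δ : ℝ, 0 ≤ δ → ∃ C : ℝ, VertexFamily H Lc C δ)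
    (hG : ∀ j : ℕ, ∃ δ C : ℝ, 0 < δ ∧ 0 ≤ C ∧ Decays (G j) C δ) (cE cVH cΛ : ℝ) (j : ℕ) :
    ∃ C δ : ℝ, 0 < δ ∧ LocStencil (e3OfK Lc (G j) (SrecOf d Lc V H G cE cVH cΛ j)) C δ := by
  have hLc : 1 ≤ Lc := Nat.one_le_iff_ne_zero.mpr (NeZero.ne Lc)
  obtain ⟨Cs, δs, hδs, hS⟩ := locStencil_SrecOf hLc hV hH hG cE cVH cΛ j
  exact locStencil_e3OfK (N := Lc) hLc (hG j) hS hδs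

/-! ## §2 Level `j+1`: the cubic and border sectors; the Λ sector dies on class slot data -/

/-- [folklore] **THE CLASS-WEIGHTED CURRENT OF `SrecOf … (j+1)`, WEIGHTED LEG FIRST, ANY FREE LEG**:
`Σ'_q h q·Σ'_u s(u_ν)·SrecOf (j+1) ν u q p (inl β) a = (cE·wE_{j+1})·[same for e3OfK Lc (G j) (SrecOf j)] + (cVH·wVH_{j+1})·[same for V]` for a class slot datum `s` ((M3) kills the Λ sector). -/
theorem classCurrent_SrecOf_succ_eq (hV : ∀ δ : ℝ, 0 ≤ δ → ∃ C : ℝ, LocStencil V C δ) (hH : ∀ δ : ℝ, 0 ≤ δ → ∃ C : ℝ, VertexFamily H Lc C δ)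
    (hG : ∀ j : ℕ, ∃ δ C : ℝ, 0 < δ ∧ 0 ≤ C ∧ Decays (G j) C δ) (cE cVH cΛ : ℝ) (j : ℕ) (ν β : Fin (d + 1))
    {h : Site (d + 1) → ℝ} {Bh : ℝ} (hh : ∀ q, |h q| ≤ Bh) (c : ℝ) (Φ : ℤ → ℝ) {B : ℝ} (hΦ : ∀ s, |Φ s| ≤ B) (p : Site (d + 1)) (a : Fib d) :
    ∑' q : Site (d + 1), h q * ∑' u : Site (d + 1), (c + (Φ (u ν + 1) - Φ (u ν))) * SrecOf d Lc V H G cE cVH cΛ (j + 1) ν u q p (Sum.inl β) a =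
      (cE * wE d Lc (j + 1)) * ∑' q : Site (d + 1), h q * ∑' u : Site (d + 1), (c + (Φ (u ν + 1) - Φ (u ν))) *
          e3OfK Lc (G j) (SrecOf d Lc V H G cE cVH cΛ j) ν u q p (Sum.inl β) a
        + (cVH * wVH d Lc (j + 1)) * ∑' q : Site (d + 1), h q * ∑' u : Site (d + 1), (c + (Φ (u ν + 1) - Φ (u ν))) * V ν u q p (Sum.inl β) a := by
  obtain ⟨C₁, δ₁, hδ₁, h1⟩ := exists_locStencil_eSectorOf (d := d) hV hH hG cE cVH cΛ j
  obtain ⟨C₂, h2⟩ := hV 1 zero_le_one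
  obtain ⟨C₃, δ₃, hδ₃, h3⟩ := exists_locStencil_lamSectorK_of_tables (d := d) (Lc := Lc) hH j
  have hs : ∀ u : Site (d + 1), |c + (Φ (u ν + 1) - Φ (u ν))| ≤ |c| + (B + B) := fun u => abs_classDatum_le c Φ hΦ (u ν)
  have ept : ∀ u q : Site (d + 1), SrecOf d Lc V H G cE cVH cΛ (j + 1) ν u q p (Sum.inl β) a =
      (cE * wE d Lc (j + 1)) * e3OfK Lc (G j) (SrecOf d Lc V H G cE cVH cΛ j) ν u q p (Sum.inl β) a
        + (cVH * wVH d Lc (j + 1)) * V ν u q p (Sum.inl β) a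
        + (cΛ * wΛ d Lc (j + 1)) * SLam Lc (lamCoeffK (KInvStep (d := d) Lc (j + 1)) (E2 d Lc (j + 1)) Lc) H ν u q p (Sum.inl β) a := by
    intro u q
    rw [SrecOf_succ]
    simp only [Pi.add_apply, Pi.smul_apply, smul_eq_mul]
  have einner : ∀ q : Site (d + 1), ∑' u : Site (d + 1), (c + (Φ (u ν + 1) - Φ (u ν))) * SrecOf d Lc V H G cE cVH cΛ (j + 1) ν u q p (Sum.inl β) a =
      (cE * wE d Lc (j + 1)) * ∑' u : Site (d + 1), (c + (Φ (u ν + 1) - Φ (u ν))) * e3OfK Lc (G j) (SrecOf d Lc V H G cE cVH cΛ j) ν u q p (Sum.inl β) a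
        + (cVH * wVH d Lc (j + 1)) * ∑' u : Site (d + 1), (c + (Φ (u ν + 1) - Φ (u ν))) * V ν u q p (Sum.inl β) a := by
    intro q
    have e : ∀ u : Site (d + 1), (c + (Φ (u ν + 1) - Φ (u ν))) * SrecOf d Lc V H G cE cVH cΛ (j + 1) ν u q p (Sum.inl β) a =
        (cE * wE d Lc (j + 1)) * ((c + (Φ (u ν + 1) - Φ (u ν))) * e3OfK Lc (G j) (SrecOf d Lc V H G cE cVH cΛ j) ν u q p (Sum.inl β) a)
          + (cVH * wVH d Lc (j + 1)) * ((c + (Φ (u ν + 1) - Φ (u ν))) * V ν u q p (Sum.inl β) a)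
          + (cΛ * wΛ d Lc (j + 1)) * ((c + (Φ (u ν + 1) - Φ (u ν))) *
            SLam Lc (lamCoeffK (KInvStep (d := d) Lc (j + 1)) (E2 d Lc (j + 1)) Lc) H ν u q p (Sum.inl β) a) := by
      intro u; rw [ept u q]; ring
    rw [tsum_congr e, (((summable_slot_locStencil h1 hδ₁ hs ν q p _ _).mul_left _).add ((summable_slot_locStencil h2 one_pos hs ν q p _ _).mul_left _)).tsum_add
      ((summable_slot_locStencil h3 hδ₃ hs ν q p _ _).mul_left _), ((summable_slot_locStencil h1 hδ₁ hs ν q p _ _).mul_left _).tsum_add ((summable_slot_locStencil h2 one_pos hs ν q p _ _).mul_left _),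
      tsum_mul_left, tsum_mul_left, tsum_mul_left, tsum_classSlot_lamSectorK_eq_zero_of_tables hH j ν c Φ hΦ q p (Sum.inl β) a, mul_zero, add_zero]
  have e : ∀ q : Site (d + 1), h q * ∑' u : Site (d + 1), (c + (Φ (u ν + 1) - Φ (u ν))) * SrecOf d Lc V H G cE cVH cΛ (j + 1) ν u q p (Sum.inl β) a =
      (cE * wE d Lc (j + 1)) * (h q * ∑' u : Site (d + 1), (c + (Φ (u ν + 1) - Φ (u ν))) * e3OfK Lc (G j) (SrecOf d Lc V H G cE cVH cΛ j) ν u q p (Sum.inl β) a)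
        + (cVH * wVH d Lc (j + 1)) * (h q * ∑' u : Site (d + 1), (c + (Φ (u ν + 1) - Φ (u ν))) * V ν u q p (Sum.inl β) a) := by
    intro q; rw [einner q]; ring
  rw [tsum_congr e, ((summable_leg_slot_fst h1 hδ₁ hh hs ν p _ _).mul_left _).tsum_add ((summable_leg_slot_fst h2 one_pos hh hs ν p _ _).mul_left _),
    tsum_mul_left, tsum_mul_left]

/-- [folklore] **THE SYMMETRISED CURRENT OF `SrecOf … (j+1)` VANISHES AT A FREE LEG WHEN THOSE OF ITS CUBIC AND BORDER SECTORS DO** (class data on both the slot and the leg). -/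
theorem sym_SrecOf_succ_of_sectors (hV : ∀ δ : ℝ, 0 ≤ δ → ∃ C : ℝ, LocStencil V C δ) (hH : ∀ δ : ℝ, 0 ≤ δ → ∃ C : ℝ, VertexFamily H Lc C δ)
    (hG : ∀ j : ℕ, ∃ δ C : ℝ, 0 < δ ∧ 0 ≤ C ∧ Decays (G j) C δ) (cE cVH cΛ : ℝ) (j : ℕ) (ν β : Fin (d + 1))
    (c₁ : ℝ) (Φ₁ : ℤ → ℝ) {B₁ : ℝ} (hΦ₁ : ∀ s, |Φ₁ s| ≤ B₁) (c₂ : ℝ) (Φ₂ : ℤ → ℝ) {B₂ : ℝ} (hΦ₂ : ∀ s, |Φ₂ s| ≤ B₂) (p : Site (d + 1)) (a : Fib d)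
    (hE : (∑' q : Site (d + 1), (c₁ + (Φ₁ (q β + 1) - Φ₁ (q β))) * ∑' u : Site (d + 1), (c₂ + (Φ₂ (u ν + 1) - Φ₂ (u ν))) *
          e3OfK Lc (G j) (SrecOf d Lc V H G cE cVH cΛ j) ν u q p (Sum.inl β) a) +
        ∑' q : Site (d + 1), (c₂ + (Φ₂ (q ν + 1) - Φ₂ (q ν))) * ∑' u : Site (d + 1), (c₁ + (Φ₁ (u β + 1) - Φ₁ (u β))) *
          e3OfK Lc (G j) (SrecOf d Lc V H G cE cVH cΛ j) β u q p (Sum.inl ν) a = 0)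
    (hVH : (∑' q : Site (d + 1), (c₁ + (Φ₁ (q β + 1) - Φ₁ (q β))) * ∑' u : Site (d + 1), (c₂ + (Φ₂ (u ν + 1) - Φ₂ (u ν))) * V ν u q p (Sum.inl β) a) +
        ∑' q : Site (d + 1), (c₂ + (Φ₂ (q ν + 1) - Φ₂ (q ν))) * ∑' u : Site (d + 1), (c₁ + (Φ₁ (u β + 1) - Φ₁ (u β))) * V β u q p (Sum.inl ν) a = 0) :
    (∑' q : Site (d + 1), (c₁ + (Φ₁ (q β + 1) - Φ₁ (q β))) * ∑' u : Site (d + 1), (c₂ + (Φ₂ (u ν + 1) - Φ₂ (u ν))) * SrecOf d Lc V H G cE cVH cΛ (j + 1) ν u q p (Sum.inl β) a) +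
      ∑' q : Site (d + 1), (c₂ + (Φ₂ (q ν + 1) - Φ₂ (q ν))) * ∑' u : Site (d + 1), (c₁ + (Φ₁ (u β + 1) - Φ₁ (u β))) * SrecOf d Lc V H G cE cVH cΛ (j + 1) β u q p (Sum.inl ν) a = 0 := by
  rw [classCurrent_SrecOf_succ_eq hV hH hG cE cVH cΛ j ν β (fun q => abs_classDatum_le c₁ Φ₁ hΦ₁ (q β)) c₂ Φ₂ hΦ₂ p a,
    classCurrent_SrecOf_succ_eq hV hH hG cE cVH cΛ j β ν (fun q => abs_classDatum_le c₂ Φ₂ hΦ₂ (q ν)) c₁ Φ₁ hΦ₁ p a]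
  have e : ∀ (x y A B A' B' : ℝ), (x * A + y * B) + (x * A' + y * B') = x * (A + A') + y * (B + B') := by intros; ring
  rw [e, hE, hVH, mul_zero, mul_zero, add_zero]

/-! ## §3 Level `0`: the slotted native spine `S0NOf V H` -/

/-- [folklore] **THE CLASS-WEIGHTED CURRENT OF `S0NOf V H`, WEIGHTED LEG FIRST, ANY FREE LEG**: `= cE·[same for wilsonA] + cVH·[same for V]` (the level-`0` Λ sector dies by (M3)). -/
theorem classCurrent_S0NOf_eq (hV : ∀ δ : ℝ, 0 ≤ δ → ∃ C : ℝ, LocStencil V C δ) (hH : ∀ δ : ℝ, 0 ≤ δ → ∃ C : ℝ, VertexFamily H Lc C δ)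
    (cE cVH cΛ : ℝ) (ν β : Fin (d + 1))
    {h : Site (d + 1) → ℝ} {Bh : ℝ} (hh : ∀ q, |h q| ≤ Bh) (c : ℝ) (Φ : ℤ → ℝ) {B : ℝ} (hΦ : ∀ s, |Φ s| ≤ B) (p : Site (d + 1)) (a : Fib d) :
    ∑' q : Site (d + 1), h q * ∑' u : Site (d + 1), (c + (Φ (u ν + 1) - Φ (u ν))) * S0NOf d Lc V H cE cVH cΛ ν u q p (Sum.inl β) a =
      cE * ∑' q : Site (d + 1), h q * ∑' u : Site (d + 1), (c + (Φ (u ν + 1) - Φ (u ν))) * wilsonA d ν u q p (Sum.inl β) a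
        + cVH * ∑' q : Site (d + 1), h q * ∑' u : Site (d + 1), (c + (Φ (u ν + 1) - Φ (u ν))) * V ν u q p (Sum.inl β) a := by
  have h1 := locStencil_wilsonA (d := d) zero_le_one
  obtain ⟨C₂, h2⟩ := hV 1 zero_le_one
  obtain ⟨C₃, δ₃, hδ₃, h3⟩ := exists_locStencil_lamSectorOf_of_tables (d := d) (Lc := Lc) hH
  have hs : ∀ u : Site (d + 1), |c + (Φ (u ν + 1) - Φ (u ν))| ≤ |c| + (B + B) := fun u => abs_classDatum_le c Φ hΦ (u ν)
  have ept : ∀ u q : Site (d + 1), S0NOf d Lc V H cE cVH cΛ ν u q p (Sum.inl β) a =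
      cE * wilsonA d ν u q p (Sum.inl β) a + cVH * V ν u q p (Sum.inl β) a
        + cΛ * SLam Lc (lamCoeffOf (KInv (N := Lc) (d := d)) Lc) H ν u q p (Sum.inl β) a := by
    intro u q
    simp only [S0NOf, Pi.add_apply, Pi.smul_apply, smul_eq_mul]
  have einner : ∀ q : Site (d + 1), ∑' u : Site (d + 1), (c + (Φ (u ν + 1) - Φ (u ν))) * S0NOf d Lc V H cE cVH cΛ ν u q p (Sum.inl β) a =
      cE * ∑' u : Site (d + 1), (c + (Φ (u ν + 1) - Φ (u ν))) * wilsonA d ν u q p (Sum.inl β) a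
        + cVH * ∑' u : Site (d + 1), (c + (Φ (u ν + 1) - Φ (u ν))) * V ν u q p (Sum.inl β) a := by
    intro q
    have e : ∀ u : Site (d + 1), (c + (Φ (u ν + 1) - Φ (u ν))) * S0NOf d Lc V H cE cVH cΛ ν u q p (Sum.inl β) a =
        cE * ((c + (Φ (u ν + 1) - Φ (u ν))) * wilsonA d ν u q p (Sum.inl β) a)
          + cVH * ((c + (Φ (u ν + 1) - Φ (u ν))) * V ν u q p (Sum.inl β) a)
          + cΛ * ((c + (Φ (u ν + 1) - Φ (u ν))) * SLam Lc (lamCoeffOf (KInv (N := Lc) (d := d)) Lc) H ν u q p (Sum.inl β) a) := by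
      intro u; rw [ept u q]; ring
    rw [tsum_congr e, (((summable_slot_locStencil h1 one_pos hs ν q p _ _).mul_left _).add ((summable_slot_locStencil h2 one_pos hs ν q p _ _).mul_left _)).tsum_add
      ((summable_slot_locStencil h3 hδ₃ hs ν q p _ _).mul_left _), ((summable_slot_locStencil h1 one_pos hs ν q p _ _).mul_left _).tsum_add ((summable_slot_locStencil h2 one_pos hs ν q p _ _).mul_left _),
      tsum_mul_left, tsum_mul_left, tsum_mul_left, tsum_classSlot_lamSectorOf_eq_zero_of_tables hH ν c Φ hΦ q p (Sum.inl β) a, mul_zero, add_zero]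
  have e : ∀ q : Site (d + 1), h q * ∑' u : Site (d + 1), (c + (Φ (u ν + 1) - Φ (u ν))) * S0NOf d Lc V H cE cVH cΛ ν u q p (Sum.inl β) a =
      cE * (h q * ∑' u : Site (d + 1), (c + (Φ (u ν + 1) - Φ (u ν))) * wilsonA d ν u q p (Sum.inl β) a)
        + cVH * (h q * ∑' u : Site (d + 1), (c + (Φ (u ν + 1) - Φ (u ν))) * V ν u q p (Sum.inl β) a) := by
    intro q; rw [einner q]; ring
  rw [tsum_congr e, ((summable_leg_slot_fst h1 one_pos hh hs ν p _ _).mul_left _).tsum_add ((summable_leg_slot_fst h2 one_pos hh hs ν p _ _).mul_left _),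
    tsum_mul_left, tsum_mul_left]

/-- [folklore] **THE SYMMETRISED CURRENT OF `S0NOf V H` VANISHES AT A FREE LEG WHEN THOSE OF ITS WILSON AND BORDER SECTORS DO**. -/
theorem sym_S0NOf_of_sectors (hV : ∀ δ : ℝ, 0 ≤ δ → ∃ C : ℝ, LocStencil V C δ) (hH : ∀ δ : ℝ, 0 ≤ δ → ∃ C : ℝ, VertexFamily H Lc C δ)
    (cE cVH cΛ : ℝ) (ν β : Fin (d + 1))
    (c₁ : ℝ) (Φ₁ : ℤ → ℝ) {B₁ : ℝ} (hΦ₁ : ∀ s, |Φ₁ s| ≤ B₁) (c₂ : ℝ) (Φ₂ : ℤ → ℝ) {B₂ : ℝ} (hΦ₂ : ∀ s, |Φ₂ s| ≤ B₂) (p : Site (d + 1)) (a : Fib d)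
    (hW : (∑' q : Site (d + 1), (c₁ + (Φ₁ (q β + 1) - Φ₁ (q β))) * ∑' u : Site (d + 1), (c₂ + (Φ₂ (u ν + 1) - Φ₂ (u ν))) * wilsonA d ν u q p (Sum.inl β) a) +
        ∑' q : Site (d + 1), (c₂ + (Φ₂ (q ν + 1) - Φ₂ (q ν))) * ∑' u : Site (d + 1), (c₁ + (Φ₁ (u β + 1) - Φ₁ (u β))) * wilsonA d β u q p (Sum.inl ν) a = 0)
    (hVH : (∑' q : Site (d + 1), (c₁ + (Φ₁ (q β + 1) - Φ₁ (q β))) * ∑' u : Site (d + 1), (c₂ + (Φ₂ (u ν + 1) - Φ₂ (u ν))) * V ν u q p (Sum.inl β) a) +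
        ∑' q : Site (d + 1), (c₂ + (Φ₂ (q ν + 1) - Φ₂ (q ν))) * ∑' u : Site (d + 1), (c₁ + (Φ₁ (u β + 1) - Φ₁ (u β))) * V β u q p (Sum.inl ν) a = 0) :
    (∑' q : Site (d + 1), (c₁ + (Φ₁ (q β + 1) - Φ₁ (q β))) * ∑' u : Site (d + 1), (c₂ + (Φ₂ (u ν + 1) - Φ₂ (u ν))) * S0NOf d Lc V H cE cVH cΛ ν u q p (Sum.inl β) a) +
      ∑' q : Site (d + 1), (c₂ + (Φ₂ (q ν + 1) - Φ₂ (q ν))) * ∑' u : Site (d + 1), (c₁ + (Φ₁ (u β + 1) - Φ₁ (u β))) * S0NOf d Lc V H cE cVH cΛ β u q p (Sum.inl ν) a = 0 := by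
  rw [classCurrent_S0NOf_eq hV hH cE cVH cΛ ν β (fun q => abs_classDatum_le c₁ Φ₁ hΦ₁ (q β)) c₂ Φ₂ hΦ₂ p a,
    classCurrent_S0NOf_eq hV hH cE cVH cΛ β ν (fun q => abs_classDatum_le c₂ Φ₂ hΦ₂ (q ν)) c₁ Φ₁ hΦ₁ p a]
  have e : ∀ (x y A B A' B' : ℝ), (x * A + y * B) + (x * A' + y * B') = x * (A + A') + y * (B + B') := by intros; ring
  rw [e, hW, hVH, mul_zero, mul_zero, add_zero]

/-! ## §4 The slotted (A)-tower -/

section Tower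

variable (hV : ∀ δ : ℝ, 0 ≤ δ → ∃ C : ℝ, LocStencil V C δ) (hH : ∀ δ : ℝ, 0 ≤ δ → ∃ C : ℝ, VertexFamily H Lc C δ)
  (hG : ∀ j : ℕ, ∃ δ C : ℝ, 0 < δ ∧ 0 ≤ C ∧ Decays (G j) C δ) (hGt : ∀ j : ℕ, trK (G j) = sgnK (G j))
  (hRH : ∀ j : ℕ, ∃ cH : ℝ, ∀ (a : Fin (d + 1)) (f : ℤ → ℝ) (B : ℝ), (∀ s, |f s| ≤ B) → ∀ (κ : Fin (d + 1)) (u : Site (d + 1)),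
    ∑' y : Site (d + 1), f (y a) * colH (G j) Lc a y κ u = cH * (if κ = a ∧ u a % (Lc : ℤ) = (Lc : ℤ) - 1 then f (blk Lc u a) else 0))
  (hRM : ∀ (j : ℕ) (a : Fin (d + 1)) (f : ℤ → ℝ) (B : ℝ), (∀ s, |f s| ≤ B) → ∀ (m : Fin (d + 1)) (q : Site (d + 1)),
    ∑' y : Site (d + 1), f (y a) * G j q ((Lc : ℤ) • y) (Sum.inr m) (Sum.inr a) = 0)
  (hVsym : ∀ (ν β : Fin (d + 1)) (h s : ℤ → ℝ), (∀ n : ℤ, n % (Lc : ℤ) ≠ (Lc : ℤ) - 1 → h n = 0) → (∀ n : ℤ, n % (Lc : ℤ) ≠ (Lc : ℤ) - 1 → s n = 0) →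
    ∀ (p : Site (d + 1)) (a : Fib d),
      (∑' q : Site (d + 1), h (q β) * ∑' u : Site (d + 1), s (u ν) * V ν u q p (Sum.inl β) a) +
        ∑' q : Site (d + 1), s (q ν) * ∑' u : Site (d + 1), h (u β) * V β u q p (Sum.inl ν) a = 0)
  (cE cVH cΛ : ℝ)
include hV hH hG hGt hRH hRM hVsym

/-- [folklore] **THE SLOTTED (A)-TOWER**: for every `j`, all directions `ν β`, all face-supported class data `c₁ + dΨ₁` (leg), `c₂ + dΨ₂` (slot) with bounded `Ψ`'s, and every free leg `(p, a)`,
`P_{SrecOf d Lc V H G cE cVH cΛ j}[c₂+dΨ₂, c₁+dΨ₁](p,a) = 0` — induction on `j`: level `0` by `sym_wilsonA` + the V-letter, the step by (M1b)'s `sym_e3OfK_of_wardLetters` at `G j` + the V-letter. -/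
theorem sym_SrecOf_all :
    ∀ (j : ℕ) (ν β : Fin (d + 1)) (c₁ : ℝ) (Ψ₁ : ℤ → ℝ) (B₁ : ℝ), (∀ s, |Ψ₁ s| ≤ B₁) → (∀ n : ℤ, n % (Lc : ℤ) ≠ (Lc : ℤ) - 1 → c₁ + (Ψ₁ (n + 1) - Ψ₁ n) = 0) →
      ∀ (c₂ : ℝ) (Ψ₂ : ℤ → ℝ) (B₂ : ℝ), (∀ s, |Ψ₂ s| ≤ B₂) → (∀ n : ℤ, n % (Lc : ℤ) ≠ (Lc : ℤ) - 1 → c₂ + (Ψ₂ (n + 1) - Ψ₂ n) = 0) →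
      ∀ (p : Site (d + 1)) (a : Fib d),
        (∑' q : Site (d + 1), (c₁ + (Ψ₁ (q β + 1) - Ψ₁ (q β))) * ∑' u : Site (d + 1), (c₂ + (Ψ₂ (u ν + 1) - Ψ₂ (u ν))) * SrecOf d Lc V H G cE cVH cΛ j ν u q p (Sum.inl β) a) +
          ∑' q : Site (d + 1), (c₂ + (Ψ₂ (q ν + 1) - Ψ₂ (q ν))) * ∑' u : Site (d + 1), (c₁ + (Ψ₁ (u β + 1) - Ψ₁ (u β))) * SrecOf d Lc V H G cE cVH cΛ j β u q p (Sum.inl ν) a = 0 := by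
  have hLc : 1 ≤ Lc := Nat.one_le_iff_ne_zero.mpr (NeZero.ne Lc)
  intro j
  induction j with
  | zero =>
    intro ν β c₁ Ψ₁ B₁ hΨ₁ hf₁ c₂ Ψ₂ B₂ hΨ₂ hf₂ p a
    simp only [SrecOf_zero]
    exact sym_S0NOf_of_sectors hV hH cE cVH cΛ ν β c₁ Ψ₁ hΨ₁ c₂ Ψ₂ hΨ₂ p a
      (sym_wilsonA ν β (fun n => c₂ + (Ψ₂ (n + 1) - Ψ₂ n)) (fun n => c₁ + (Ψ₁ (n + 1) - Ψ₁ n)) p a)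
      (hVsym ν β (fun n => c₁ + (Ψ₁ (n + 1) - Ψ₁ n)) (fun n => c₂ + (Ψ₂ (n + 1) - Ψ₂ n)) hf₁ hf₂ p a)
  | succ j ih =>
    intro ν β c₁ Ψ₁ B₁ hΨ₁ hf₁ c₂ Ψ₂ B₂ hΨ₂ hf₂ p a
    obtain ⟨Cs, δs, hδs, hS⟩ := locStencil_SrecOf (d := d) hLc hV hH hG cE cVH cΛ j
    obtain ⟨δK, CK, hδK, _, hGj⟩ := hG j
    obtain ⟨cH, hRHj⟩ := hRH j
    exact sym_SrecOf_succ_of_sectors hV hH hG cE cVH cΛ j ν β c₁ Ψ₁ hΨ₁ c₂ Ψ₂ hΨ₂ p a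
      (sym_e3OfK_of_wardLetters hGj hδK (hGt j) hRHj (hRM j) hS hδs ν β
        (fun c₁' Ψ₁' B₁' h₁ f₁ c₂' Ψ₂' B₂' h₂ f₂ p' a' => ih ν β c₁' Ψ₁' B₁' h₁ f₁ c₂' Ψ₂' B₂' h₂ f₂ p' a') c₁ Ψ₁ hΨ₁ c₂ Ψ₂ hΨ₂ p a)
      (hVsym ν β (fun n => c₁ + (Ψ₁ (n + 1) - Ψ₁ n)) (fun n => c₂ + (Ψ₂ (n + 1) - Ψ₂ n)) hf₁ hf₂ p a)

/-! ## §5 The pure tables `SpureRecOf … j` -/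

/-- [folklore] **THE SLOTTED (A)-TOWER FOR THE PURE TABLES `SpureRecOf d Lc V H G cE cVH cΛ j`** (every `j`: Wilson∕cubic sector by §4 one level down, border sector by the V-letter). -/
theorem sym_SpureRecOf (j : ℕ) (ν β : Fin (d + 1))
    (c₁ : ℝ) (Ψ₁ : ℤ → ℝ) {B₁ : ℝ} (hΨ₁ : ∀ s, |Ψ₁ s| ≤ B₁) (hf₁ : ∀ n : ℤ, n % (Lc : ℤ) ≠ (Lc : ℤ) - 1 → c₁ + (Ψ₁ (n + 1) - Ψ₁ n) = 0)
    (c₂ : ℝ) (Ψ₂ : ℤ → ℝ) {B₂ : ℝ} (hΨ₂ : ∀ s, |Ψ₂ s| ≤ B₂) (hf₂ : ∀ n : ℤ, n % (Lc : ℤ) ≠ (Lc : ℤ) - 1 → c₂ + (Ψ₂ (n + 1) - Ψ₂ n) = 0)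
    (p : Site (d + 1)) (a : Fib d) :
    (∑' q : Site (d + 1), (c₁ + (Ψ₁ (q β + 1) - Ψ₁ (q β))) * ∑' u : Site (d + 1), (c₂ + (Ψ₂ (u ν + 1) - Ψ₂ (u ν))) * SpureRecOf d Lc V H G cE cVH cΛ j ν u q p (Sum.inl β) a) +
      ∑' q : Site (d + 1), (c₂ + (Ψ₂ (q ν + 1) - Ψ₂ (q ν))) * ∑' u : Site (d + 1), (c₁ + (Ψ₁ (u β + 1) - Ψ₁ (u β))) * SpureRecOf d Lc V H G cE cVH cΛ j β u q p (Sum.inl ν) a = 0 := by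
  have hLc : 1 ≤ Lc := Nat.one_le_iff_ne_zero.mpr (NeZero.ne Lc)
  have hb₁ : ∀ q : Site (d + 1), |c₁ + (Ψ₁ (q β + 1) - Ψ₁ (q β))| ≤ |c₁| + (B₁ + B₁) := fun q => abs_classDatum_le c₁ Ψ₁ hΨ₁ (q β)
  have hb₁' : ∀ u : Site (d + 1), |c₁ + (Ψ₁ (u β + 1) - Ψ₁ (u β))| ≤ |c₁| + (B₁ + B₁) := fun u => abs_classDatum_le c₁ Ψ₁ hΨ₁ (u β)
  have hb₂ : ∀ u : Site (d + 1), |c₂ + (Ψ₂ (u ν + 1) - Ψ₂ (u ν))| ≤ |c₂| + (B₂ + B₂) := fun u => abs_classDatum_le c₂ Ψ₂ hΨ₂ (u ν)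
  have hb₂' : ∀ q : Site (d + 1), |c₂ + (Ψ₂ (q ν + 1) - Ψ₂ (q ν))| ≤ |c₂| + (B₂ + B₂) := fun q => abs_classDatum_le c₂ Ψ₂ hΨ₂ (q ν)
  have hVH := hVsym ν β (fun n => c₁ + (Ψ₁ (n + 1) - Ψ₁ n)) (fun n => c₂ + (Ψ₂ (n + 1) - Ψ₂ n)) hf₁ hf₂ p a
  obtain ⟨C₂, h2⟩ := hV 1 zero_le_one
  have e : ∀ (x y A B A' B' : ℝ), (x * A + y * B) + (x * A' + y * B') = x * (A + A') + y * (B + B') := by intros; ring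
  cases j with
  | zero =>
    have h1 := locStencil_wilsonA (d := d) zero_le_one
    have hW := sym_wilsonA ν β (fun n => c₂ + (Ψ₂ (n + 1) - Ψ₂ n)) (fun n => c₁ + (Ψ₁ (n + 1) - Ψ₁ n)) p a
    simp only [SpureRecOf_zero_level]
    rw [classCurrent_add_smul_eq h1 one_pos h2 one_pos cE cVH ν β hb₁ hb₂ p a, classCurrent_add_smul_eq h1 one_pos h2 one_pos cE cVH β ν hb₂' hb₁' p a, e, hW, hVH,
      mul_zero, mul_zero, add_zero]
  | succ j =>
    obtain ⟨C₁, δ₁, hδ₁, h1⟩ := exists_locStencil_eSectorOf (d := d) hV hH hG cE cVH cΛ j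
    obtain ⟨Cs, δs, hδs, hS⟩ := locStencil_SrecOf (d := d) hLc hV hH hG cE cVH cΛ j
    obtain ⟨δK, CK, hδK, _, hGj⟩ := hG j
    obtain ⟨cH, hRHj⟩ := hRH j
    have hE := sym_e3OfK_of_wardLetters hGj hδK (hGt j) hRHj (hRM j) hS hδs ν β
      (fun c₁' Ψ₁' B₁' h₁ f₁ c₂' Ψ₂' B₂' h₂ f₂ p' a' => sym_SrecOf_all hV hH hG hGt hRH hRM hVsym cE cVH cΛ j ν β c₁' Ψ₁' B₁' h₁ f₁ c₂' Ψ₂' B₂' h₂ f₂ p' a')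
      c₁ Ψ₁ hΨ₁ c₂ Ψ₂ hΨ₂ p a
    simp only [SpureRecOf_succ]
    rw [classCurrent_add_smul_eq h1 hδ₁ h2 one_pos _ _ ν β hb₁ hb₂ p a, classCurrent_add_smul_eq h1 hδ₁ h2 one_pos _ _ β ν hb₂' hb₁' p a, e, hE, hVH,
      mul_zero, mul_zero, add_zero]

end Tower

end Summit.QuantumFields.BalabanUV.Beta.GAN24.CurrentSymTowerOfTables

end
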